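import Summits.QuantumFields.BalabanUV.T4Continuum.Spine.NE7.QLaAbelianBlockContraction
import Literature.MathematicalPhysics.QuantumFieldTheory.Balaban1983to89.T4AdaptedReference

/-!
# Spine/NE7/QLaBondDeviationBridge — the abstract half of the bridge from a PER-ENTRY (one-bond) bound to NODE S's
# per-coarse-bond deviation shape `BondDevBound`: «a FRAMED one-bond Lipschitz bound on a fibre-convex domain family ⟹
# `BondDevBound`» (telescoping over the support), plus `BondDevBound` ⇐ NE1a-STEP and its inhabitant in the abelian block model

Cell `pub-balaban-gaps` (YM blitz Y1, track G2, seat `ne7`, generation 5); text of record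
`run/shared/lean/pub/pub-balaban-gaps/ne/NE7.md` v5 §4sexies, census row R39.  Twelfth `Spine/NE7/` file; companion of file 11
`Spine/NE7/QLaFlatAveragingL1` (the same telescoping carried out CONCRETELY for the B7 fold's `k`-fold double-bar averaging
`logIter` on `ℤ^d`, with [Balaban1985Averaging] Prop. 5 (156) at `U₀ = 1` as the per-entry input).

WHY.  NODE S (= (QL-a)∣_{U=1}) consumes `HolDevBound` ⇐ `BondDevBound av dom Cb θ` (file 8 `QLaHolonomyDefect` §1b): for every
domain configuration `V` of level `k` there is a coarse gauge transformation `u` with EVERY bond variable of `(avgⁿ V)^u` within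
`Cb · tv(1, V) · θⁿ` of the identity.  The PRINTED source is a per-ENTRY statement — [Balaban1985Averaging] Prop. 5 (156) p. 42:
the derivative of ONE coarse bond variable of the composed averaging with respect to ONE fine bond variable, taken for the
double-bar (frame-reduced) average (89) `V̿(c) = v(c₋)⁻¹ V̄(c) v(c₊)`, whose block frames `v` (110) ARE a coarse gauge
transformation depending on the configuration.  The passage per-entry ⟹ per-coarse-bond is pure bookkeeping once the
per-entry bound is phrased as a ONE-BOND LIPSCHITZ property of the FRAMED average `V ↦ (avgⁿ V)^{fr(V)}` (§2, shape
`FramedBondLip av dom Cb θ`: a frame map `fr : GaugeField k → GaugeTransf (k+n)` under which the framed average of the trivial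
configuration is trivial and changing ONE fine bond moves every framed coarse bond variable by at most `Cb·θⁿ` times the
change): switch the bonds of `V` on one at a time from the trivial configuration (each intermediate configuration lies in the
domain by `FibreConvex`, the tree's box property of `T4AvgDerivBound`) and add up — §3 `bondDevBound_of_framedBondLip`, the
witness gauge being `fr V`.  This is the torus-vocabulary twin of file 11's induction; instantiating `FramedBondLip` for a
`Setup.Averaging` realising Bałaban's (15) on the torus from file 11's `ℤ^d` theorem is the DICTIONARY half (b) of the bridge
(corner ↔ centre blocks, periodisation — DIVERGENCES F3∕F6 of the `pub-balaban` cell), chartered to seat g2-p6 and NOT done here.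
§4 records the cheap implication NE1a-STEP ⟹ `BondDevBound` (`Cb = 1`; via the tree's `descend`: total variation dominates
every single bond deviation), whence §5: `BondDevBound` is INHABITED with `θ = L^{1−d}` in the abelian block model of files
9∕10 (`bondDevBound_linAvg`), every hypothesis discharged.

HONEST FRAMING.  [folklore] bookkeeping over the tree's abstract `GaugeGroup` ∕ `Averaging` vocabulary; `FramedBondLip` is a
HYPOTHESIS SHAPE consumed as a hypothesis (cell typing, NOT a printed statement; the printed input it abstracts — (156) with
(138), in the frame gauge (159)–(160) — is cited in prose and PROVED for the B7 fold's `ℤ^d` model in file 11 ∕ `B7Prop5Flat`);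
nothing of Bałaban's averaging on the torus, of its (158)-box domains, or of the (1.100) insert of [Balaban1989LargeFieldI] is
asserted.  (QL-a) NOT IN PRINT ([Balaban1989LargeFieldII] p. 356 defers observables); NE7 NOT proved; spine 0∕9; fixed finite
T⁴ — NOT ℝ⁴, NOT infinite volume, NOT a mass gap, NOT Clay.
-/

noncomputable section

open Finset
open scoped BigOperators

namespace Summit.QuantumFields.BalabanUV.T4Continuum.Spine.NE7

open Literature.MathematicalPhysics.QuantumFieldTheory.Balaban1983to89
open Literature.MathematicalPhysics.QuantumFieldTheory.Balaban1983to89.T4Continuum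
open Literature.MathematicalPhysics.QuantumFieldTheory.Balaban1983to89.T4AvgSensitivity
open Literature.MathematicalPhysics.QuantumFieldTheory.Balaban1983to89.T4AvgDerivBound
open Literature.MathematicalPhysics.QuantumFieldTheory.Balaban1983to89.T4AdaptedReference (bdist_triangle)

variable {P : Params} {G : Type*} [GaugeGroup G]

/-! ## §1 (The invariant bond distance `bdist`: `bdist_self` of `T4AvgDerivBound` and `bdist_triangle` of `T4AdaptedReference`
are REUSED by name.) -/

/-! ## §2 The framed one-bond Lipschitz shape — the form in which a per-entry Jacobian bound is consumed -/

/-- [shape] HYPOTHESIS SHAPE — THE FRAMED ONE-BOND LIPSCHITZ BOUND (cell typing, generation 5; consumed only as a hypothesis):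
for all levels `k` and all `n` with `k + n ≤ m + K` there is a FRAME MAP `fr : GaugeField P k G → GaugeTransf P (k+n) G` such that
(i) the framed `n`-fold average of the trivial configuration is trivial, and (ii) for two domain configurations `V, V′`
differing at ONE bond `b` only, EVERY framed coarse bond variable moves by at most `Cb · θⁿ · bdist(V_b, V′_b)`:
`bdist ((avgⁿ V)^{fr V} c) ((avgⁿ V′)^{fr V′} c) ≤ Cb · θⁿ · bdist (V b) (V′ b)`.  This is the per-ENTRY form in which the printed
Jacobian bound [Balaban1985Averaging] Prop. 5 (156) p. 42 (with (138) p. 39, rate `L^{1−d}` per level and entry, in the frame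
gauge (159)–(160) = the block frames (110) of the double-bar average (89)) arrives after integration along a one-bond segment;
PROVED in that integrated form for the B7 fold's concrete `k`-fold averaging on `ℤ^d` at the flat background by file 11
(`B7Flat.norm_logIter_add_bump_sub_le` ∕ `norm_logIter_le_l1`).  (Cell typing, NOT a printed statement: tagged folklore; the
printed input it abstracts is cited in prose.) [folklore] -/
def FramedBondLip (av : ∀ j, Averaging P j G) (dom : ∀ j, Set (GaugeField P j G)) (Cb θ : ℝ) : Prop :=
  ∀ (k n : ℕ), k + n ≤ P.m + P.K →
    ∃ fr : GaugeField P k G → GaugeTransf P (k + n) G,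
      (∀ c : PBond P (k + n),
          GaugeField.gaugeAct (fr 1) (iterFrom av k n (1 : GaugeField P k G)) c = 1) ∧
        ∀ (V V' : GaugeField P k G), V ∈ dom k → V' ∈ dom k →
          ∀ b : PBond P k, (∀ b', b' ≠ b → V b' = V' b') →
            ∀ c : PBond P (k + n),
              bdist (GaugeField.gaugeAct (fr V) (iterFrom av k n V) c)
                  (GaugeField.gaugeAct (fr V') (iterFrom av k n V') c)
                ≤ Cb * θ ^ n * bdist (V b) (V' b)

/-! ## §3 Telescoping over the support: `FramedBondLip` on a fibre-convex domain family ⟹ `BondDevBound` -/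

/-- TELESCOPING OF THE FRAMED AVERAGE (the tree's `LoopDerivBound.sum_of_fibreConvex`, transposed from loop variables to framed
bond variables): on a FIBRE-CONVEX domain family, the framed one-bond bound controls the change of every framed coarse bond
variable under a change of `V` on any finite set `Λ` of bonds by `Cb · θⁿ · Σ_{b∈Λ} bdist(V_b, V′_b)` — change the bonds of `Λ`
one at a time (each intermediate configuration is in the domain by fibre-convexity) and add up with `bdist_triangle`.
[folklore] -/
theorem framed_bdist_le_sum {av : ∀ j, Averaging P j G} {dom : ∀ j, Set (GaugeField P j G)} {Cb θ : ℝ}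
    (hconv : FibreConvex dom) {k n : ℕ} (fr : GaugeField P k G → GaugeTransf P (k + n) G)
    (hlip : ∀ (V V' : GaugeField P k G), V ∈ dom k → V' ∈ dom k →
      ∀ b : PBond P k, (∀ b', b' ≠ b → V b' = V' b') → ∀ c : PBond P (k + n),
        bdist (GaugeField.gaugeAct (fr V) (iterFrom av k n V) c) (GaugeField.gaugeAct (fr V') (iterFrom av k n V') c)
          ≤ Cb * θ ^ n * bdist (V b) (V' b))
    (c : PBond P (k + n)) :
    ∀ (Λ : Finset (PBond P k)) (V V' : GaugeField P k G), V ∈ dom k → V' ∈ dom k → (∀ b, b ∉ Λ → V b = V' b) →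
      bdist (GaugeField.gaugeAct (fr V) (iterFrom av k n V) c) (GaugeField.gaugeAct (fr V') (iterFrom av k n V') c)
        ≤ Cb * θ ^ n * ∑ b ∈ Λ, bdist (V b) (V' b) := by
  classical
  intro Λ
  induction Λ using Finset.induction_on with
  | empty =>
    intro V V' _ _ hΛ
    have hVV' : V = V' := funext fun b => hΛ b (by simp)
    subst hVV'
    simp only [Finset.sum_empty, mul_zero, bdist_self, le_refl]
  | @insert b Λ hb ih =>
    intro V V' hV hV' hΛ
    -- the intermediate configuration: `V` with the bond `b` already changed
    set W : GaugeField P k G := Function.update V b (V' b) with hWdef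
    have hWmem : W ∈ dom k := hconv k V V' W hV hV' fun b' => by
      by_cases hb' : b' = b
      · subst hb'; right; simp [hWdef]
      · left; simp [hWdef, Function.update_of_ne hb']
    -- first step: change `b` only
    have h1 : bdist (GaugeField.gaugeAct (fr V) (iterFrom av k n V) c) (GaugeField.gaugeAct (fr W) (iterFrom av k n W) c)
        ≤ Cb * θ ^ n * bdist (V b) (V' b) := by
      have := hlip V W hV hWmem b (fun b' hb' => by simp [hWdef, Function.update_of_ne hb']) c
      simpa only [hWdef, Function.update_self] using this
    -- remaining steps: `W` and `V'` agree off `Λ`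
    have hWΛ : ∀ b', b' ∉ Λ → W b' = V' b' := fun b' hb' => by
      by_cases hbb : b' = b
      · subst hbb; simp [hWdef]
      · have hb'' : b' ∉ insert b Λ := by simp [hbb, hb']
        simp [hWdef, Function.update_of_ne hbb, hΛ b' hb'']
    have h2 := ih W V' hWmem hV' hWΛ
    have hsumW : ∑ b' ∈ Λ, bdist (W b') (V' b') = ∑ b' ∈ Λ, bdist (V b') (V' b') := by
      refine Finset.sum_congr rfl fun b' hb' => ?_
      have hbb : b' ≠ b := fun hbb => hb (hbb ▸ hb')
      simp [hWdef, Function.update_of_ne hbb]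
    rw [hsumW] at h2
    rw [Finset.sum_insert hb, mul_add]
    exact (bdist_triangle _ _ _).trans (add_le_add h1 h2)

/-- **`FramedBondLip` ON A FIBRE-CONVEX DOMAIN FAMILY ⟹ `BondDevBound`** (kernel bookkeeping, same constant): the witness
coarse gauge transformation for `V` is the frame `fr V`; telescoping from the trivial configuration over ALL bonds of the
(finite) torus gives `bdist (1, (avgⁿ V)^{fr V} c) ≤ Cb · θⁿ · Σ_b bdist(1, V_b) = Cb · tv(1, V) · θⁿ`.  So a per-entry bound of
the printed kind (156), once phrased as `FramedBondLip` for a torus averaging, feeds NODE S through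
`holDevBound_of_bondDevBound` (file 8) and `loopDefectBound_of_holDevBound` (criticality, file 8 §3). [folklore] -/
theorem bondDevBound_of_framedBondLip {av : ∀ j, Averaging P j G} {dom : ∀ j, Set (GaugeField P j G)} {Cb θ : ℝ}
    (hconv : FibreConvex dom) (h : FramedBondLip av dom Cb θ) : BondDevBound av dom Cb θ := by
  classical
  intro k n hn V hV h1
  obtain ⟨fr, hfr1, hlip⟩ := h k n hn
  refine ⟨fr V, fun c => ?_⟩
  have htele := framed_bdist_le_sum hconv fr hlip c Finset.univ 1 V h1 hV fun b hb => absurd (Finset.mem_univ b) hb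
  rw [hfr1 c] at htele
  calc bdist ((1 : GaugeField P (k + n) G) c) (GaugeField.gaugeAct (fr V) (iterFrom av k n V) c)
      = bdist (1 : G) (GaugeField.gaugeAct (fr V) (iterFrom av k n V) c) := rfl
    _ ≤ Cb * θ ^ n * ∑ b ∈ (Finset.univ : Finset (PBond P k)), bdist ((1 : GaugeField P k G) b) (V b) := htele
    _ = Cb * (tv 1 V * θ ^ n) := by rw [tv]; ring

/-- The composite for NODE S: `FramedBondLip` on a fibre-convex family ⟹ `HolDevBound` (file 8's `holDevBound_of_bondDevBound`)
— closed-walk holonomies of `avgⁿ V` within `Cb · |w| · tv(1,V) · θⁿ` of the identity. [folklore] -/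
theorem holDevBound_of_framedBondLip {av : ∀ j, Averaging P j G} {dom : ∀ j, Set (GaugeField P j G)} {Cb θ : ℝ}
    (hconv : FibreConvex dom) (h : FramedBondLip av dom Cb θ) : HolDevBound av dom Cb θ :=
  holDevBound_of_bondDevBound (bondDevBound_of_framedBondLip hconv h)

/-! ## §4 NE1a-STEP ⟹ `BondDevBound` (total variation dominates every single bond) -/

/-- **NE1a-STEP ⟹ `BondDevBound` with `Cb = 1`** (kernel bookkeeping): if the domains propagate and are gauge stable, ONE averaging
step contracts total variation modulo a coarse gauge transformation by `θ` (`AvgStepContraction`, consumed BY NAME) and averaging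
fixes the trivial configuration (`AvgFlat`), then `descend` (tree) puts `avgⁿ V` — up to a gauge transformation `u` — within total
variation `θⁿ · tv(1, V)` of `avgⁿ 1 = 1`; undoing `u` and bounding each bond deviation by the total variation gives
`BondDevBound av dom 1 θ`.  (File 8 proved the weaker `HolDevBound` consequence directly; this is the bond-level statement.)
[folklore] -/
theorem bondDevBound_of_stepContraction {av : ∀ j, Averaging P j G} {dom : ∀ j, Set (GaugeField P j G)} {θ : ℝ}
    (hdom : DomStable av dom) (hg : GaugeStable dom) (hstep : AvgStepContraction av dom θ) (hθ : 0 ≤ θ)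
    (hflat : AvgFlat av) : BondDevBound av dom 1 θ := by
  intro k n hn V hV h1
  obtain ⟨Y, u, _, hEq, hTV⟩ := descend hdom hg hstep hθ n hn 1 V h1 hV
  rw [iterFrom_one hflat n hn] at hTV
  refine ⟨fun y => (u y)⁻¹, fun c => ?_⟩
  rw [hEq, gaugeAct_inv_gaugeAct, one_mul]
  calc bdist ((1 : GaugeField P (k + n) G) c) (Y c) ≤ tv 1 Y := bdist_le_tv 1 Y c
    _ ≤ θ ^ n * tv 1 V := hTV
    _ = tv 1 V * θ ^ n := mul_comm _ _

/-! ## §5 Non-vacuity: `BondDevBound` with `θ = L^{1−d}` in the abelian block model -/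

/-- **`BondDevBound` INHABITED WITH `θ = L^{1−d}`**: in the abelian Lie-algebra block model of files 9∕10 (Bałaban's (0.4)
exp-mean-log block averaging with the exact logarithm, `linAvg`), for EVERY configuration `V` of any level `k` and every `n`
with `k + n ≤ m + K` there is a coarse gauge in which every bond phase of `avgⁿ V` is within `tv(1, V) · (L^{1−d})ⁿ` of `0` — by §4
from `avgStepContraction_linAvg` (file 10), all hypotheses discharged (`univ` domains). [folklore] -/
theorem bondDevBound_linAvg :
    BondDevBound (fun k => (linAvg : Averaging P k LinPhase)) (fun _ => Set.univ) 1 (theta P) :=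
  bondDevBound_of_stepContraction (domStable_univ _) gaugeStable_univ avgStepContraction_linAvg (theta_nonneg P)
    avgFlat_linAvg

omit [GaugeGroup G] in
/-- `FibreConvex` holds trivially for the `univ` domain family (the abelian model's domains). [folklore] -/
theorem fibreConvex_univ : FibreConvex (P := P) (G := G) fun _ => Set.univ := fun _ _ _ _ _ _ _ => Set.mem_univ _

end Summit.QuantumFields.BalabanUV.T4Continuum.Spine.NE7

end
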